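import Summits.FinalStateConjecture.FinalStateConjecture.Statement
import Literature.Geometry.Lorentzian.KillingDevelopmentGlobalisation
import Literature.Geometry.Lorentzian.CausalityOpennessProofs
import Literature.Geometry.Lorentzian.CausalityChronologyProofs
import Literature.Geometry.Lorentzian.CausalityPushUp

/-!
# Solo (blind) — the future-set lemma behind the exhaustion step of the bag-of-gold analysis

The typed final state conjecture places the settled exterior at
`O = exteriorOf 𝒟 U = J⁺(ι X) ∩ I⁻(U)` (`U` the charted set of a decomposition) and commits every
future-complete normalised null ray from the data to `closure O` (`RaysStayInClosure`). The
analysis of candidate counterexamples (`paper/bag-of-gold-note.md`, §B5.1) starts from the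
observation that an OPEN set all of whose points are reached by complete rays is then contained in
`O` itself, not merely in its closure, so that the exhaustion clause applies to it. The underlying
causal fact is elementary:

* `soloBlind_subset_chronologicalPast_of_isOpen` — an open set contained in the closure of a
  chronological past `I⁻(U)` is contained in `I⁻(U)`: for `q ∈ L` pick `q' ∈ L` with `q ≪ q'`
  (integral curve of the orienting field), then `I⁺(q)` is an open neighbourhood of
  `q' ∈ closure I⁻(U)`, so it meets `I⁻(U)` in some `q''`, and `q ≪ q'' ≪ u ∈ U`.
* `soloBlind_subset_exteriorOf_of_isOpen` — the same for `exteriorOf 𝒟 U` and open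
  `L ⊆ J⁺(ι X)`.
* `soloBlind_subset_exteriorOf_of_rays` — under `RaysStayInClosure 𝒟 (exteriorOf 𝒟 U)`, an open
  `L ⊆ J⁺(ι X)` every point of which lies, at a parameter `t ≥ 0`, on a future-complete
  normalised null ray from the data, is contained in `exteriorOf 𝒟 U`.

References: B. O'Neill, *Semi-Riemannian geometry*, Academic Press 1983, Ch. 14, p. 402
(`≪` transitive), Lemma 14.3 (p. 403: `I⁺(S)` open); D. Christodoulou, CQG 16 (1999) A23,
pp. A26–A27 (normalised null rays).
-/

noncomputable section

open Literature.Geometry.Lorentzian Set Filter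
open scoped Manifold ContDiff Topology

set_option linter.dupNamespace false

namespace Summit.FinalStateConjecture.FinalStateConjecture.Theorems

section FutureSet

variable {E : Type*} [NormedAddCommGroup E] [NormedSpace ℝ E] [CompleteSpace E] {H : Type*}
  [TopologicalSpace H] {I : ModelWithCorners ℝ E H} {M : Type*} [TopologicalSpace M]
  [ChartedSpace H M] [IsManifold I ∞ M] [T2Space M] [BoundarylessManifold I M] {n : ℕ∞ω}
  {g : LorentzianMetric I n M} {τ : TimeOrientation g}

/-- **Future-set lemma.** In a time-oriented `Cⁿ` Lorentzian manifold without boundary (`1 ≤ n`),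
an open set contained in the closure of the chronological past `I⁻(U)` is contained in `I⁻(U)`.
O'Neill 1983, Ch. 14, p. 402 and Lemma 14.3. -/
theorem soloBlind_subset_chronologicalPast_of_isOpen (hn : 1 ≤ n) {L U : Set M} (hL : IsOpen L)
    (hcl : L ⊆ closure (g.chronologicalPast τ U)) : L ⊆ g.chronologicalPast τ U := by
  intro q hq
  obtain ⟨q', hq'L, hq'⟩ :=
    LorentzianMetric.exists_mem_chronologicalFuture_singleton_of_mem_nhds (g := g) (τ := τ) hn q
      (hL.mem_nhds hq)
  obtain ⟨q'', hq''I, hq''P⟩ := mem_closure_iff.1 (hcl hq'L) _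
    (LorentzianMetric.isOpen_chronologicalFuture_of_boundaryless g τ {q}) hq'
  have h₁ : q ∈ g.chronologicalPast τ {q''} :=
    LorentzianMetric.mem_chronologicalPast_of_mem_chronologicalFuture hq''I
  exact LorentzianMetric.mem_chronologicalFuture_trans (τ := τ.reverse) hq''P h₁

/-- The dual statement: an open set contained in the closure of `I⁺(U)` is contained in `I⁺(U)`.
O'Neill 1983, Ch. 14, p. 402 and Lemma 14.3 (time duality, p. 403). -/
theorem soloBlind_subset_chronologicalFuture_of_isOpen (hn : 1 ≤ n) {L U : Set M}
    (hL : IsOpen L) (hcl : L ⊆ closure (g.chronologicalFuture τ U)) :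
    L ⊆ g.chronologicalFuture τ U := by
  have h := soloBlind_subset_chronologicalPast_of_isOpen (g := g) (τ := τ.reverse) hn hL
    (U := U) (by rwa [LorentzianMetric.chronologicalPast_reverse])
  rwa [LorentzianMetric.chronologicalPast_reverse] at h

end FutureSet

section Exterior

variable {X : Type} [TopologicalSpace X] [ChartedSpace E3 X] [IsManifold (𝓡 3) ∞ X]
  [ConnectedSpace X] {D : InitialDataSet (𝓡 3) X}

/-- For a Cauchy development `𝒟` and any `U`: an open `L ⊆ J⁺(ι X)` contained in
`closure (exteriorOf 𝒟 U)` is contained in `exteriorOf 𝒟 U = J⁺(ι X) ∩ I⁻(U)`.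
O'Neill 1983, Ch. 14, p. 402 and Lemma 14.3. -/
theorem soloBlind_subset_exteriorOf_of_isOpen (𝒟 : CauchyDevelopment D) {U L : Set 𝒟.carrier}
    (hL : IsOpen L) (hJ : L ⊆ 𝒟.metric.causalFuture 𝒟.timeOrientation (range 𝒟.embed))
    (hcl : L ⊆ closure (exteriorOf 𝒟 U)) : L ⊆ exteriorOf 𝒟 U := fun _ hq ↦
  ⟨hJ hq, soloBlind_subset_chronologicalPast_of_isOpen (g := 𝒟.metric) (τ := 𝒟.timeOrientation)
    (WithTop.coe_le_coe.2 le_top) hL (hcl.trans (closure_mono inter_subset_right)) hq⟩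

/-- Under the clause `RaysStayInClosure 𝒟 (exteriorOf 𝒟 U)` of the typed conjecture: an open
`L ⊆ J⁺(ι X)` every point of which is `γ t` for some future-complete normalised null ray `γ` from
the data and some parameter `t ≥ 0` of its domain, is contained in `exteriorOf 𝒟 U` (not merely
in its closure). Christodoulou, CQG 16 (1999) A23, pp. A26–A27; O'Neill 1983, Ch. 14, p. 402,
Lemma 14.3. -/
theorem soloBlind_subset_exteriorOf_of_rays (𝒟 : CauchyDevelopment D) [𝒟.metric.HasLeviCivita]
    {U L : Set 𝒟.carrier} (hR : RaysStayInClosure 𝒟 (exteriorOf 𝒟 U)) (hL : IsOpen L)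
    (hJ : L ⊆ 𝒟.metric.causalFuture 𝒟.timeOrientation (range 𝒟.embed))
    (hrays : ∀ q ∈ L, ∃ (p : X) (γ : ℝ → 𝒟.carrier) (dom : Set ℝ) (t : ℝ),
      𝒟.metric.IsNormalisedNullRayFrom 𝒟.timeOrientation 𝒟.embed 𝒟.normal p γ dom ∧
        ¬ BddAbove dom ∧ t ∈ dom ∧ 0 ≤ t ∧ γ t = q) :
    L ⊆ exteriorOf 𝒟 U := by
  refine soloBlind_subset_exteriorOf_of_isOpen 𝒟 hL hJ fun q hq ↦ ?_
  obtain ⟨p, γ, dom, t, hγ, hdom, ht, h0, rfl⟩ := hrays q hq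
  exact hR p γ dom hγ hdom t ht h0

end Exterior

end Summit.FinalStateConjecture.FinalStateConjecture.Theorems
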